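import Summits.QuantumFields.YangMills.Theorems.BalabanLadderUVSeamRecCeilingsWindowCellLaws
import Summits.QuantumFields.YangMills.Theorems.BalabanLadderUVSeamRecCeilingsDLRPeelingWindowCellLaw
import HarnessLib

/-!
# Crux `UVSeamRec` (stmt-QuantumFields-20043), v5(α) stub `stub_responseMomentsOdd6` (RM), lane B: the large-field half of the (β)
# architecture from the ONE-BOX uniform conditional rarity bound (UCR) — DLR peeling glued into the (RM) press-button

Helper file (`--supports stmt-QuantumFields-20043`) of the width-lever seat `ym-20043-ceilings-p2` (lane B, gen 6); assembles this seat's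
`…CeilingsDLRPeelingWindowCellLaw` (p573746: (UCR_k) ⇒ window cell law at level `k` on every torus holding the collar cube) with lane B g3's
`…CeilingsWindowCellLaws` (p554392: window cell laws ⇒ doubled joint exponential moments of the influence functionals ⇒ (RM)).

THE GLUE.  g3's consumer asks the window cell law at level `k ≥ 1` for ALL window families, but USES it only on subfamilies of the level-`k`
FAMILY SHELL of the (RM) cube family — whose polymers satisfy `2b^k ≤ R`; at the (RM) torus (`4R+8 ≤ L`) the collar cube of side `(2m+1)b^k`
therefore fits (`(2m+1)b^k + 3 ≤ 2L+1`) as soon as `m ≤ 7`, and the peeling supplier applies.  §1 re-proves g3's engine with the law asked only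
of shell subfamilies (`…_of_shellWindowCellLaws`, proof verbatim); §2 feeds it with (UCR) (`…_of_uniformConditionalRarity`, weights
`θ_k = w_k^{1/(16K)}`, `K = 256(2m+4)⁴`); §3 is the (RM) press-button `responseMoments_of_quadratic_and_uniformConditionalRarity` — (split) +
(EM_Q) + eventual level-`0` bound `Δ₀` + (UCR) at the levels `k ≥ 1` for `β ≥ β₁` with `Σ_{1≤k≤kmax β R} w(β,k)^{1/(16K)} ≤ D` ⇒ (RM) on ALL
separated families of ALL odd tori, `B = A₀ + max(B_Q, 2e²·1536·(Δ₀ + D))` — and §4 its registered `SU(2)` twin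
`responseMomentsOdd6_of_quadratic_and_uniformConditionalRarity` (conclusion = the body of `BirthV5A.stub_responseMomentsOdd6`).

THE ONE-BOX HYPOTHESIS (UCR), block size `b ≤ m ≤ 7`: for `β ≥ β₁`, every level `k ≥ 1`, block index `y`, orientation `μ<ν` and EVERY exterior
`η`:  `kerE^η_{(b^k(y−m), (2m+1)b^k)}(1_{largeFieldEvent 𝔟 (ε β k) (k,y,μ,ν)}) ≤ w(β,k)`, `w ∈ [0,1]`.  No torus, no divisibility, no reflection
positivity: Bałaban's R-operation currency in a b-adic box with Dirichlet data.
HONEST FRAMING: composition; (split), (EM_Q) and (UCR) are OPEN renormalisation-group statements ((UCR) is classically inconsistent for thresholds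
`ε(β,k) < 1 − cos(π²/(2m+1)²) ≈ π⁴/(2(2m+1)⁴)` — flat penetration, LEAD 20043 FINDING #50 — so only schedules with a floor above it are candidates);
nothing of E0′; not
a gap, not Clay.  References: folklore; T. Bałaban, Commun. Math. Phys. 122 (1989) 355–392 (intended supplier).
-/

set_option autoImplicit false

noncomputable section

open MeasureTheory Filter Topology Finset
open Literature.Probability.LatticeModels
open Literature.MathematicalPhysics.QuantumFieldTheory (GaugeConfig wilsonMeasure isProbabilityMeasure_wilsonMeasure
  measurable_torusLift LatticeRep)
open Literature.MathematicalPhysics.QuantumLattice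

namespace Summit.QuantumFields.YangMills.Cruxes.UVSeamRec.DLRPeeling

open Summit.QuantumFields.YangMills.Cruxes.OSLegsFromFemtoAndGap.DlrCollarTransfer
open Summit.QuantumFields.YangMills.Cruxes.UVSeamRec.PolymerData
open Summit.QuantumFields.YangMills.Cruxes.UVSeamRec.TemperedResponse
open Summit.QuantumFields.YangMills.Theorems.OddTorusChessboard (Orient)

/-! ## §1 g3's engine with the window cell laws asked only of SHELL subfamilies -/

section Shell

variable {N : ℕ} [NeZero N]

/-- **DOUBLED JOINT EXPONENTIAL MOMENTS FROM WINDOW CELL LAWS ASKED ONLY OF SHELL SUBFAMILIES.**  The statement and proof of lane B g3's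
`TemperedResponse.torusE_exp_two_mul_sum_influence_le_of_windowCellLaws` (p554392) VERBATIM, except that the window cell law at level `k ≥ 1` is
asked only for window families `A` CONTAINED IN THE LEVEL-`k` FAMILY SHELL `(familyShell 𝔟 kmax R x).filter (·.k = k)` — which is all that proof
uses (it applies the law to sign classes of subfamilies of the level-`k` shell).  The point of the weakening: shell polymers satisfy `2b^k ≤ R`, so
at the (RM) torus (`4R+8 ≤ L`) the collar cube of the DLR-peeling supplier fits, and the one-box hypothesis (UCR_k) supplies this form
(`torusE_exp_two_mul_sum_influence_le_of_uniformConditionalRarity`).  Conclusion unchanged: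
`⟨exp(2 Σ_{i∈T} influence∘lift)⟩_{2L+1,β} ≤ exp(2e²·1536·(δ₀ + Σ_{1 ≤ k ≤ kmax} θ k)·#T)`. [folklore] -/
theorem torusE_exp_two_mul_sum_influence_le_of_shellWindowCellLaws :
    ∃ K₀ : ℝ, ∃ D₁ : ℕ, ∀ (𝔟 : BlockSize) (ε : ℕ → ℝ) (kmax R L : ℕ) (β : ℝ), 1 ≤ β → ∀ {n : ℕ} (x : Fin n → (Fin 4 → ℤ)),
      1 ≤ R → 4 * R + 8 ≤ L → (∀ i c, |x i c| ≤ (L : ℤ)) →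
      (∀ i j : Fin n, i ≠ j → ∃ k : Fin 4,
        (2 * (R : ℤ) + 4) ≤ |((((x i k - x j k : ℤ) : ZMod (2 * L + 1))).valMinAbs : ℤ)|) →
      ∀ (θ δ : ℕ → ℝ), (∀ k, 0 ≤ θ k) → (∀ k, θ k ≤ 1) → (∀ k, 0 ≤ δ k) → (∀ k, δ k ≤ θ k ^ 16) →
      (∀ k : ℕ, 1 ≤ k → ∀ (o : Fin 4 → ℤ) (A : Finset Polymer), A ⊆ (familyShell 𝔟 kmax R x).filter (fun γ => γ.k = k) →
        (∀ γ ∈ A, ∀ c, o c ≤ anchor 𝔟 γ c ∧ anchor 𝔟 γ c + (𝔟.b : ℤ) ^ k ≤ o c + (2 * L + 1)) →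
        torusE (Matrix.specialUnitaryGroup (Fin N) ℂ) (fundamentalLatticeRep N) β L (fun U => ∏ γ ∈ A,
          (largeFieldEvent (N := N) 𝔟 (ε k) γ).indicator (fun _ => (1 : ℝ)) U) ≤ ∏ _γ ∈ A, δ k) →
      ∀ T : Finset (Fin n),
        torusE (Matrix.specialUnitaryGroup (Fin N) ℂ) (fundamentalLatticeRep N) β L
            (fun U => Real.exp (((2 : ℕ) : ℝ) * ∑ i ∈ T, influence (N := N) 𝔟 ε kmax R (x i) U)) ≤
          Real.exp (2 * Real.exp (2 * 1) * (1536 * (Real.exp (-(β * ((N : ℝ) * ε 0)) / Fintype.card (Orient 4) +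
            (K₀ + D₁ * Real.log β) / Fintype.card (Orient 4)) +
            ∑ k ∈ (Finset.range (kmax + 1)).filter (fun k => 1 ≤ k), θ k)) * T.card) := by
  classical
  obtain ⟨K₀, D₁, hPL0⟩ := torusE_prod_indicator_levelZero_le (N := N)
  refine ⟨K₀, D₁, ?_⟩
  intro 𝔟 ε kmax R L β hβ n x hR hRL hred hsep θ δ hθ0 hθ1 hδ0 hδθ hWCL T
  have hL : 1 ≤ L := by omega
  set δ₀ : ℝ := Real.exp (-(β * ((N : ℝ) * ε 0)) / Fintype.card (Orient 4) + (K₀ + D₁ * Real.log β) / Fintype.card (Orient 4))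
    with hδ₀def
  have hδ₀0 : 0 ≤ δ₀ := (Real.exp_pos _).le
  -- level weights: the proved level-0 activity at level 0, `θ k` above
  set W : ℕ → ℝ := fun k => if k = 0 then δ₀ else θ k with hWdef
  have hW0 : ∀ k, 0 ≤ W k := fun k => by
    by_cases hk : k = 0
    · simp only [hWdef, hk, if_true]; exact hδ₀0
    · simp only [hWdef, hk, if_false]; exact hθ0 k
  set fS := familyShell 𝔟 kmax R x with hfS
  -- the levelwise composition with weights `w γ = W γ.k`
  have key := torusE_exp_two_mul_sum_influence_le_of_levelwise (N := N) (fundamentalLatticeRep N) 𝔟 ε kmax R L β x hRL hsep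
    (W := 1536 * (δ₀ + ∑ k ∈ (Finset.range (kmax + 1)).filter (fun k => 1 ≤ k), θ k))
    (fun γ => W γ.k) (fun γ _ => hW0 γ.k) ?_ ?_ T
  · simpa only [hδ₀def] using key
  · -- the budget: tempered-d1's per-level count
    intro i
    refine (sum_familyCoeff_mul_level_weight_le 𝔟 kmax R x i W hW0).trans (le_of_eq ?_)
    congr 1
    rw [← Finset.sum_filter_add_sum_filter_not (Finset.range (kmax + 1)) (fun k => k = 0)]
    have h0 : ∑ k ∈ (Finset.range (kmax + 1)).filter (fun k => k = 0), W k = δ₀ := by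
      have : (Finset.range (kmax + 1)).filter (fun k => k = 0) = {0} := by
        ext k
        simp only [Finset.mem_filter, Finset.mem_range, Finset.mem_singleton]
        constructor
        · exact fun h => h.2
        · intro h; subst h; exact ⟨Nat.succ_pos _, rfl⟩
      rw [this, Finset.sum_singleton]
      simp only [hWdef, if_true]
    have h1 : ∑ k ∈ (Finset.range (kmax + 1)).filter (fun k => ¬ k = 0), W k =
        ∑ k ∈ (Finset.range (kmax + 1)).filter (fun k => 1 ≤ k), θ k := by
      have : (Finset.range (kmax + 1)).filter (fun k => ¬ k = 0) = (Finset.range (kmax + 1)).filter (fun k => 1 ≤ k) :=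
        Finset.filter_congr fun k _ => Nat.one_le_iff_ne_zero.symm
      rw [this]
      refine Finset.sum_congr rfl fun k hk => ?_
      have hk1 : ¬ k = 0 := Nat.one_le_iff_ne_zero.1 (Finset.mem_filter.1 hk).2
      simp only [hWdef, hk1, if_false]
    rw [h0, h1]
  · -- the per-level laws
    intro k A hA hinj
    have hAk : ∀ γ ∈ A, γ.k = k := fun γ hγ => (Finset.mem_filter.1 (hA hγ)).2
    have hlhs : (fun U => ∏ γ ∈ A, (largeFieldEvent (N := N) 𝔟 (ε γ.k) γ).indicator (fun _ => (1 : ℝ)) U) =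
        fun U => ∏ γ ∈ A, (largeFieldEvent (N := N) 𝔟 (ε k) γ).indicator (fun _ => (1 : ℝ)) U := by
      funext U
      exact Finset.prod_congr rfl fun γ hγ => by rw [hAk γ hγ]
    have hrhs : ∏ γ ∈ A, W γ.k = ∏ _γ ∈ A, W k := Finset.prod_congr rfl fun γ hγ => by rw [hAk γ hγ]
    rw [hlhs, hrhs]
    by_cases hk : k = 0
    · -- level 0: the proved law (period-free families)
      subst hk
      have h := hPL0 𝔟 (ε 0) L hL β hβ A hAk hinj
      simpa only [hWdef, if_true, hδ₀def] using h
    · -- level k ≥ 1: the largest sign class does not wrap; window cell law; δ ≤ θ^16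
      have hk1 : 1 ≤ k := Nat.one_le_iff_ne_zero.2 hk
      simp only [hWdef, hk, if_false, Finset.prod_const]
      obtain ⟨s, hs⟩ := exists_signClass 𝔟 A
      set A' := A.filter (fun γ => (fun c => decide (0 ≤ anchor 𝔟 γ c)) = s) with hA'
      have hA'sub : A' ⊆ A := Finset.filter_subset _ _
      set o : Fin 4 → ℤ := fun c => if s c then (0 : ℤ) else -((L : ℤ) + 2 * R + 2) with ho
      have hwin : ∀ γ ∈ A', ∀ c, o c ≤ anchor 𝔟 γ c ∧ anchor 𝔟 γ c + (𝔟.b : ℤ) ^ k ≤ o c + (2 * L + 1) := by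
        intro γ hγ c
        have h1 := Finset.mem_filter.1 hγ
        have hγk : γ.k = k := hAk γ h1.1
        have hw := anchor_window_of_signClass 𝔟 kmax R L hRL x hred (Finset.mem_filter.1 (hA h1.1)).1 s h1.2 c
        rw [hγk] at hw
        simpa only [ho] using hw
      have hcell := hWCL k hk1 o A' (hA'sub.trans hA) hwin
      calc torusE (Matrix.specialUnitaryGroup (Fin N) ℂ) (fundamentalLatticeRep N) β L (fun U => ∏ γ ∈ A,
              (largeFieldEvent (N := N) 𝔟 (ε k) γ).indicator (fun _ => (1 : ℝ)) U)
          ≤ torusE (Matrix.specialUnitaryGroup (Fin N) ℂ) (fundamentalLatticeRep N) β L (fun U => ∏ γ ∈ A',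
              (largeFieldEvent (N := N) 𝔟 (ε k) γ).indicator (fun _ => (1 : ℝ)) U) :=
            torusE_prod_indicator_anti (fundamentalLatticeRep N) β L _ (fun γ => measurableSet_largeFieldEvent (N := N) 𝔟 _ γ) hA'sub
        _ ≤ ∏ _γ ∈ A', δ k := hcell
        _ = δ k ^ A'.card := Finset.prod_const _
        _ ≤ (θ k ^ 16) ^ A'.card := pow_le_pow_left₀ (hδ0 k) (hδθ k) _
        _ = θ k ^ (16 * A'.card) := by rw [← pow_mul]
        _ ≤ θ k ^ A.card := pow_le_pow_of_le_one (hθ0 k) (hθ1 k) hs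


end Shell

/-! ## §2 The doubled joint exponential moments of the influence functionals from (UCR) -/

section UCR

variable {N : ℕ} [NeZero N]

/-- A polymer of the family shell has `2b^k ≤ R`; hence at the (RM) torus (`4R+8 ≤ L`) its collar cube of side `(2m+1)b^k`, `m ≤ 7`, fits:
`(2m+1)b^k + 3 ≤ 2L+1`. [folklore] -/
theorem collarCube_fits_of_mem_familyShell (𝔟 : BlockSize) {m : ℕ} (hm7 : m ≤ 7) (kmax R L : ℕ) (hRL : 4 * R + 8 ≤ L) {n : ℕ}
    (x : Fin n → (Fin 4 → ℤ)) {γ : Polymer} (hγ : γ ∈ familyShell 𝔟 kmax R x) :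
    (2 * m + 1) * 𝔟.b ^ γ.k + 3 ≤ 2 * L + 1 := by
  obtain ⟨i, _, hi⟩ := Finset.mem_biUnion.1 hγ
  have hshell := (mem_shell_iff 𝔟 kmax R (x i) γ).1 hi
  have h2 : 2 * 𝔟.b ^ γ.k ≤ R := by have := hshell.2.1.trans hshell.2.2; omega
  have h15 : (2 * m + 1) * 𝔟.b ^ γ.k ≤ 15 * 𝔟.b ^ γ.k := Nat.mul_le_mul_right _ (by omega)
  omega

/-- **DOUBLED JOINT EXPONENTIAL MOMENTS OF THE INFLUENCE FUNCTIONALS FROM (UCR).**  Fundamental Wilson state of `SU(N)` on the odd torus `2L+1`,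
`β ≥ 1`; a REDUCED cube family (`|x i c| ≤ L`), pairwise cyclically `2R+4`-separated, `1 ≤ R`, `4R+8 ≤ L`; block size `𝔟`, collar `b ≤ m ≤ 7`,
thresholds `ε`, cutoff `kmax`; weights `w k ∈ [0,1]` with the ONE-BOX bound (UCR_k) at every level `k ≥ 1`:
`∀ y μ<ν η, kerE^η_{(b^k(y−m),(2m+1)b^k)}(1_{largeFieldEvent 𝔟 (ε k) (k,y,μ,ν)}) ≤ w k`.  THEN, with the constants `K₀, D₁` of the proved level-`0` law
and `K = 256(2m+4)⁴`:  `⟨exp(2 Σ_{i∈T} influence 𝔟 ε kmax R (x i)∘lift)⟩_{2L+1,β} ≤ exp(2e²·1536·(δ₀ + Σ_{1≤k≤kmax} (w k)^{1/(16K)})·#T)`.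
Proof: §1 with `θ k = (w k)^{1/(16K)}`, `δ k = (w k)^{1/K}`, the shell law supplied by `torusE_prod_indicator_largeField_le_of_uniformKernelBound`
(the collar cube fits by `collarCube_fits_of_mem_familyShell`; an empty family is trivial).  No RP, no divisibility. [folklore] -/
theorem torusE_exp_two_mul_sum_influence_le_of_uniformConditionalRarity :
    ∃ K₀ : ℝ, ∃ D₁ : ℕ, ∀ (𝔟 : BlockSize) (m : ℕ), 𝔟.b ≤ m → m ≤ 7 → ∀ (ε : ℕ → ℝ) (kmax R L : ℕ) (β : ℝ), 1 ≤ β →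
      ∀ {n : ℕ} (x : Fin n → (Fin 4 → ℤ)), 1 ≤ R → 4 * R + 8 ≤ L → (∀ i c, |x i c| ≤ (L : ℤ)) →
      (∀ i j : Fin n, i ≠ j → ∃ k : Fin 4,
        (2 * (R : ℤ) + 4) ≤ |((((x i k - x j k : ℤ) : ZMod (2 * L + 1))).valMinAbs : ℤ)|) →
      ∀ (w : ℕ → ℝ), (∀ k, 0 ≤ w k) → (∀ k, w k ≤ 1) →
      (∀ k : ℕ, 1 ≤ k → ∀ (y : Fin 4 → ℤ) (μ ν : Fin 4) (h : μ < ν) (η : LGConfig 4 (Matrix.specialUnitaryGroup (Fin N) ℂ)),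
        kerE (Matrix.specialUnitaryGroup (Fin N) ℂ) (fundamentalLatticeRep N) β (fun i => (𝔟.b : ℤ) ^ k * (y i - m)) ((2 * m + 1) * 𝔟.b ^ k) η
          ((largeFieldEvent (N := N) 𝔟 (ε k) ⟨k, y, μ, ν, h⟩).indicator fun _ => (1 : ℝ)) ≤ w k) →
      ∀ T : Finset (Fin n),
        torusE (Matrix.specialUnitaryGroup (Fin N) ℂ) (fundamentalLatticeRep N) β L
            (fun U => Real.exp (((2 : ℕ) : ℝ) * ∑ i ∈ T, influence (N := N) 𝔟 ε kmax R (x i) U)) ≤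
          Real.exp (2 * Real.exp (2 * 1) * (1536 * (Real.exp (-(β * ((N : ℝ) * ε 0)) / Fintype.card (Orient 4) +
            (K₀ + D₁ * Real.log β) / Fintype.card (Orient 4)) +
            ∑ k ∈ (Finset.range (kmax + 1)).filter (fun k => 1 ≤ k), w k ^ ((1 : ℝ) / (16 * (256 * (2 * m + 4) ^ 4))))) * T.card) := by
  classical
  obtain ⟨K₀, D₁, hShell⟩ := torusE_exp_two_mul_sum_influence_le_of_shellWindowCellLaws (N := N)
  refine ⟨K₀, D₁, ?_⟩
  intro 𝔟 m hm hm7 ε kmax R L β hβ n x hR hRL hred hsep w hw0 hw1 hUCR T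
  haveI := isProbabilityMeasure_wilsonMeasure (d := 4) (L := 2 * L + 1) (fundamentalLatticeRep N).ρ
    (fundamentalLatticeRep N).continuous β
  set K : ℝ := 256 * (2 * (m : ℝ) + 4) ^ 4 with hKdef
  have hK0 : 0 < K := by rw [hKdef]; positivity
  -- weights `θ k = (w k)^{1/(16K)}`, activities `δ k = (w k)^{1/K}`
  set θ : ℕ → ℝ := fun k => w k ^ ((1 : ℝ) / (16 * K)) with hθdef
  set δ : ℕ → ℝ := fun k => w k ^ ((1 : ℝ) / K) with hδdef
  have hθ0 : ∀ k, 0 ≤ θ k := fun k => Real.rpow_nonneg (hw0 k) _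
  have hθ1 : ∀ k, θ k ≤ 1 := fun k => Real.rpow_le_one (hw0 k) (hw1 k) (by positivity)
  have hδ0 : ∀ k, 0 ≤ δ k := fun k => Real.rpow_nonneg (hw0 k) _
  have hδθ : ∀ k, δ k ≤ θ k ^ 16 := fun k => by
    simp only [hθdef, hδdef]
    rw [← Real.rpow_natCast (w k ^ ((1 : ℝ) / (16 * K))) 16, ← Real.rpow_mul (hw0 k),
      show (1 : ℝ) / (16 * K) * ((16 : ℕ) : ℝ) = 1 / K by field_simp; ring]
  have h := hShell 𝔟 ε kmax R L β hβ x hR hRL hred hsep θ δ hθ0 hθ1 hδ0 hδθ ?_ T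
  · simpa only [hθdef, hKdef] using h
  -- the shell law from (UCR): the collar cube fits for shell polymers
  intro k hk o A hA hwin
  have hAk : ∀ γ ∈ A, γ.k = k := fun γ hγ => (Finset.mem_filter.1 (hA hγ)).2
  rcases A.eq_empty_or_nonempty with hAe | ⟨γ₀, hγ₀⟩
  · subst hAe
    simp only [Finset.prod_empty]
    unfold torusE
    rw [integral_const, smul_eq_mul, mul_one, probReal_univ]
  have hfit : (2 * m + 1) * 𝔟.b ^ k + 3 ≤ 2 * L + 1 := by
    have h := collarCube_fits_of_mem_familyShell 𝔟 hm7 kmax R L hRL x (Finset.mem_filter.1 (hA hγ₀)).1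
    rwa [hAk γ₀ hγ₀] at h
  have hlaw := torusE_prod_indicator_largeField_le_of_uniformKernelBound (N := N) (fundamentalLatticeRep N) β 𝔟 m hm (ε k) k L hfit
    (w k) (hw0 k) (hw1 k) (hUCR k hk) o A hAk hwin
  simpa only [hδdef, hKdef] using hlaw

end UCR

/-! ## §3 (RM) on ALL families of ALL odd tori from (split) + (EM_Q) + (UCR) -/

section Button

variable {N : ℕ} [NeZero N]

/-- **(RM) FROM THE (β) SPLIT, (EM_Q) AND THE ONE-BOX UNIFORM CONDITIONAL RARITY BOUND (UCR) AT THE LEVELS `k ≥ 1`.**  Fundamental representation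
of `SU(N)`, any unit `a`; block size `𝔟`, collar `b ≤ m ≤ 7`, thresholds `ε β k`, cutoff `kmax β R`.  Hypotheses: (split) for all exteriors against
`A₀ + Q + influenceAt 𝔟 ε kmax`; (EM_Q); the eventual bound `Δ₀` of the PROVED level-`0` activity; weights `w β k ∈ [0,1]` with (UCR) for `β ≥ β₁`,
`k ≥ 1`: `∀ y μ<ν η, kerE^η_{(b^k(y−m),(2m+1)b^k)}(1_{largeFieldEvent 𝔟 (ε β k) (k,y,μ,ν)}) ≤ w β k`; and the budget
`Σ_{1 ≤ k ≤ kmax β R} (w β k)^{1/(16·256(2m+4)⁴)} ≤ D`.  THEN (RM) for `β ≥ β₁'` on ALL separated families of ALL odd tori with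
`B = A₀ + max(B_Q, 2e²·1536·(Δ₀ + D))`.  Proof: g3's seam reduction + §2.  No reflection positivity, no divisibility anywhere; the large-field
input is a statement about ONE b-adic box with Dirichlet data.  HONEST FRAMING: composition of OPEN RG inputs; nothing of E0′. [folklore] -/
theorem responseMoments_of_quadratic_and_uniformConditionalRarity (a : ℝ → ℝ) (𝔟 : BlockSize) (m : ℕ) (hm : 𝔟.b ≤ m) (hm7 : m ≤ 7)
    (ε : ℝ → ℕ → ℝ) (kmax : ℝ → ℕ → ℕ) {C₁ β₁ ℓ₁ A₀ B_Q D Δ₀ : ℝ} {p : Fin 4 × Fin 4 → ℝ → ℝ}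
    (Q : ℝ → ℕ → Fin 4 × Fin 4 → (Fin 4 → ℤ) → LGConfig 4 (Matrix.specialUnitaryGroup (Fin N) ℂ) → ℝ)
    (MQ : ℝ → ℕ → Fin 4 × Fin 4 → (Fin 4 → ℤ) → ℝ)
    (hQm : ∀ β R q x, Measurable (Q β R q x)) (hQb : ∀ β R q x η, |Q β R q x η| ≤ MQ β R q x)
    (hsplit : ∀ β : ℝ, β₁ ≤ β → ∀ R : ℕ, 1 ≤ R → (R : ℝ) * a β ≤ ℓ₁ →
      ∀ (q : Fin 4 × Fin 4) (x : Fin 4 → ℤ), q.1 < q.2 → ∀ η : LGConfig 4 (Matrix.specialUnitaryGroup (Fin N) ℂ),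
        (R : ℝ) ^ 4 / C₁ * |kerE (Matrix.specialUnitaryGroup (Fin N) ℂ) (fundamentalLatticeRep N) β (fun k => x k - (R + 1))
          (2 * R + 3) η (plane (Matrix.specialUnitaryGroup (Fin N) ℂ) (fundamentalLatticeRep N) q x) - p q β| ≤
          A₀ + Q β R q x η + influenceAt (N := N) 𝔟 ε kmax β R q x η)
    (hEMQ : ∀ β : ℝ, β₁ ≤ β → ∀ (L n : ℕ) (q : Fin n → Fin 4 × Fin 4) (x : Fin n → (Fin 4 → ℤ)) (R : ℕ),
      (∀ i, (q i).1 < (q i).2) → 1 ≤ R → (R : ℝ) * a β ≤ ℓ₁ → 4 * R + 8 ≤ L →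
      (∀ i j : Fin n, i ≠ j → ∃ k : Fin 4,
        (2 * (R : ℤ) + 4) ≤ |((((x i k - x j k : ℤ) : ZMod (2 * L + 1))).valMinAbs : ℤ)|) →
      ∀ T : Finset (Fin n),
        torusE (Matrix.specialUnitaryGroup (Fin N) ℂ) (fundamentalLatticeRep N) β L
          (fun U => Real.exp (((2 : ℕ) : ℝ) * ∑ i ∈ T, Q β R (q i) (x i) U)) ≤ Real.exp (B_Q * T.card))
    (hδ₀ : ∀ (K₀ : ℝ) (D₁ : ℕ), ∃ β₀ : ℝ, ∀ β : ℝ, β₀ ≤ β →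
      Real.exp (-(β * ((N : ℝ) * ε β 0)) / Fintype.card (Orient 4) + (K₀ + D₁ * Real.log β) / Fintype.card (Orient 4)) ≤ Δ₀)
    (w : ℝ → ℕ → ℝ) (hw0 : ∀ β k, 0 ≤ w β k) (hw1 : ∀ β k, w β k ≤ 1)
    (hUCR : ∀ β : ℝ, β₁ ≤ β → ∀ k : ℕ, 1 ≤ k → ∀ (y : Fin 4 → ℤ) (μ ν : Fin 4) (h : μ < ν)
      (η : LGConfig 4 (Matrix.specialUnitaryGroup (Fin N) ℂ)),
      kerE (Matrix.specialUnitaryGroup (Fin N) ℂ) (fundamentalLatticeRep N) β (fun i => (𝔟.b : ℤ) ^ k * (y i - m)) ((2 * m + 1) * 𝔟.b ^ k) η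
        ((largeFieldEvent (N := N) 𝔟 (ε β k) ⟨k, y, μ, ν, h⟩).indicator fun _ => (1 : ℝ)) ≤ w β k)
    (hD : ∀ β : ℝ, β₁ ≤ β → ∀ R : ℕ,
      ∑ k ∈ (Finset.range (kmax β R + 1)).filter (fun k => 1 ≤ k), w β k ^ ((1 : ℝ) / (16 * (256 * (2 * m + 4) ^ 4))) ≤ D) :
    ∃ β₁' : ℝ, ∀ β : ℝ, β₁' ≤ β → ∀ (L n : ℕ) (q : Fin n → Fin 4 × Fin 4) (x : Fin n → (Fin 4 → ℤ)) (R : ℕ),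
      (∀ i, (q i).1 < (q i).2) → 1 ≤ R → (R : ℝ) * a β ≤ ℓ₁ → 4 * R + 8 ≤ L →
      (∀ i j : Fin n, i ≠ j → ∃ k : Fin 4,
        (2 * (R : ℤ) + 4) ≤ |((((x i k - x j k : ℤ) : ZMod (2 * L + 1))).valMinAbs : ℤ)|) →
      ∀ T : Finset (Fin n),
        torusE (Matrix.specialUnitaryGroup (Fin N) ℂ) (fundamentalLatticeRep N) β L (fun U => Real.exp (∑ i ∈ T, (R : ℝ) ^ 4 / C₁ *
          |kerE (Matrix.specialUnitaryGroup (Fin N) ℂ) (fundamentalLatticeRep N) β (fun k => x i k - (R + 1)) (2 * R + 3) U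
            (plane (Matrix.specialUnitaryGroup (Fin N) ℂ) (fundamentalLatticeRep N) (q i) (x i)) - p (q i) β|)) ≤
          Real.exp ((A₀ + max B_Q (2 * Real.exp (2 * 1) * (1536 * (Δ₀ + D)))) * T.card) := by
  classical
  obtain ⟨K₀, D₁, hLF⟩ := torusE_exp_two_mul_sum_influence_le_of_uniformConditionalRarity (N := N)
  obtain ⟨β₀, hβ₀⟩ := hδ₀ K₀ D₁
  refine ⟨max (max β₁ 1) β₀, ?_⟩
  refine responseMoments_of_quadratic_and_reducedLF (fundamentalLatticeRep N) a (β₁ := max (max β₁ 1) β₀)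
    Q (influenceAt (N := N) 𝔟 ε kmax) (fun β R q x => max (MQ β R q x) (coeffMass 𝔟 (kmax β R) R x)) hQm
    (fun β R q x η => (hQb β R q x η).trans (le_max_left _ _))
    (fun β R q x => measurable_influenceAt (N := N) 𝔟 ε kmax β R q x)
    (fun β R q x η => (abs_influenceAt_le (N := N) 𝔟 ε kmax β R q x η).trans (le_max_right _ _))
    (fun β hβ => hsplit β ((le_max_left _ _).trans ((le_max_left _ _).trans hβ)))
    (fun β hβ => hEMQ β ((le_max_left _ _).trans ((le_max_left _ _).trans hβ))) ?_
  intro β hβ L n q x R hq hR hRa hRL hred hsep T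
  have hβ₁ : β₁ ≤ β := (le_max_left _ _).trans ((le_max_left _ _).trans hβ)
  have hβ1 : 1 ≤ β := (le_max_right _ _).trans ((le_max_left _ _).trans hβ)
  have hββ₀ : β₀ ≤ β := (le_max_right _ _).trans hβ
  have h := hLF 𝔟 m hm hm7 (ε β) (kmax β R) R L β hβ1 x hR hRL hred hsep (w β) (hw0 β) (hw1 β)
    (fun k hk y μ ν hμν η => hUCR β hβ₁ k hk y μ ν hμν η) T
  refine (le_of_eq ?_).trans (h.trans (Real.exp_le_exp.2 ?_))
  · simp only [influenceAt_eq]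
  · refine mul_le_mul_of_nonneg_right ?_ (Nat.cast_nonneg _)
    have h1 := hβ₀ β hββ₀
    have h2 := hD β hβ₁ R
    have h3 : 0 ≤ 2 * Real.exp (2 * 1) := by positivity
    exact mul_le_mul_of_nonneg_left (mul_le_mul_of_nonneg_left (add_le_add h1 h2) (by norm_num)) h3

end Button

/-! ## §4 At the registered stub (SU(2), fundamental representation, unit of record) -/

section Unit

/-- **The body of `stub_responseMomentsOdd6` from the (β) split, (EM_Q), a vanishing level-`0` activity and the ONE-BOX uniform conditional rarity
bound (UCR) at the levels `k ≥ 1` with summable `16K`-th roots of the weights.**  `SU(2)`, fundamental representation, unit `a ≤ c·uRec` eventually;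
conclusion = the registered body with `B = A₀ + max(B_Q, 2e²·1536·(Δ₀ + D))`.  The lane-B supplier target of the (β) architecture in BOX-LOCAL
currency, by name: `hUCR` + `hD` — one scale and one b-adic box at a time, Dirichlet data, no torus, no RP, no divisibility.  HONEST FRAMING:
composition of OPEN RG inputs; nothing of E0′. [folklore] -/
theorem responseMomentsOdd6_of_quadratic_and_uniformConditionalRarity {a : ℝ → ℝ} {c C₁ β₁ ℓ₁ A₀ B_Q D Δ₀ P₀ : ℝ}
    {p : Fin 4 × Fin 4 → ℝ → ℝ} (hc : 0 < c) (hle : ∀ᶠ β in atTop, a β ≤ c * Transport.uRec β) (hℓ₁ : 0 < ℓ₁)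
    (hC₁ : 0 < C₁) (hp : ∀ q β, |p q β| ≤ P₀) (𝔟 : BlockSize) (m : ℕ) (hm : 𝔟.b ≤ m) (hm7 : m ≤ 7) (ε : ℝ → ℕ → ℝ)
    (kmax : ℝ → ℕ → ℕ)
    (Q : ℝ → ℕ → Fin 4 × Fin 4 → (Fin 4 → ℤ) → LGConfig 4 (Matrix.specialUnitaryGroup (Fin 2) ℂ) → ℝ)
    (MQ : ℝ → ℕ → Fin 4 × Fin 4 → (Fin 4 → ℤ) → ℝ)
    (hQm : ∀ β R q x, Measurable (Q β R q x)) (hQb : ∀ β R q x η, |Q β R q x η| ≤ MQ β R q x)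
    (hsplit : ∀ β : ℝ, β₁ ≤ β → ∀ R : ℕ, 1 ≤ R → (R : ℝ) * a β ≤ ℓ₁ →
      ∀ (q : Fin 4 × Fin 4) (x : Fin 4 → ℤ), q.1 < q.2 → ∀ η : LGConfig 4 (Matrix.specialUnitaryGroup (Fin 2) ℂ),
        (R : ℝ) ^ 4 / C₁ * |kerE (Matrix.specialUnitaryGroup (Fin 2) ℂ) (fundamentalLatticeRep 2) β (fun k => x k - (R + 1))
          (2 * R + 3) η (plane (Matrix.specialUnitaryGroup (Fin 2) ℂ) (fundamentalLatticeRep 2) q x) - p q β| ≤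
          A₀ + Q β R q x η + influenceAt (N := 2) 𝔟 ε kmax β R q x η)
    (hEMQ : ∀ β : ℝ, β₁ ≤ β → ∀ (L n : ℕ) (q : Fin n → Fin 4 × Fin 4) (x : Fin n → (Fin 4 → ℤ)) (R : ℕ),
      (∀ i, (q i).1 < (q i).2) → 1 ≤ R → (R : ℝ) * a β ≤ ℓ₁ → 4 * R + 8 ≤ L →
      (∀ i j : Fin n, i ≠ j → ∃ k : Fin 4,
        (2 * (R : ℤ) + 4) ≤ |((((x i k - x j k : ℤ) : ZMod (2 * L + 1))).valMinAbs : ℤ)|) →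
      ∀ T : Finset (Fin n),
        torusE (Matrix.specialUnitaryGroup (Fin 2) ℂ) (fundamentalLatticeRep 2) β L
          (fun U => Real.exp (((2 : ℕ) : ℝ) * ∑ i ∈ T, Q β R (q i) (x i) U)) ≤ Real.exp (B_Q * T.card))
    (hδ₀ : ∀ (K₀ : ℝ) (D₁ : ℕ), ∃ β₀ : ℝ, ∀ β : ℝ, β₀ ≤ β →
      Real.exp (-(β * ((2 : ℕ) * ε β 0 : ℝ)) / Fintype.card (Orient 4) + (K₀ + D₁ * Real.log β) / Fintype.card (Orient 4)) ≤ Δ₀)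
    (w : ℝ → ℕ → ℝ) (hw0 : ∀ β k, 0 ≤ w β k) (hw1 : ∀ β k, w β k ≤ 1)
    (hUCR : ∀ β : ℝ, β₁ ≤ β → ∀ k : ℕ, 1 ≤ k → ∀ (y : Fin 4 → ℤ) (μ ν : Fin 4) (h : μ < ν)
      (η : LGConfig 4 (Matrix.specialUnitaryGroup (Fin 2) ℂ)),
      kerE (Matrix.specialUnitaryGroup (Fin 2) ℂ) (fundamentalLatticeRep 2) β (fun i => (𝔟.b : ℤ) ^ k * (y i - m)) ((2 * m + 1) * 𝔟.b ^ k) η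
        ((largeFieldEvent (N := 2) 𝔟 (ε β k) ⟨k, y, μ, ν, h⟩).indicator fun _ => (1 : ℝ)) ≤ w β k)
    (hD : ∀ β : ℝ, β₁ ≤ β → ∀ R : ℕ,
      ∑ k ∈ (Finset.range (kmax β R + 1)).filter (fun k => 1 ≤ k), w β k ^ ((1 : ℝ) / (16 * (256 * (2 * m + 4) ^ 4))) ≤ D) :
    ∃ (a : ℝ → ℝ) (c : ℝ) (C₁ B β₁ ℓ₁ P₀ : ℝ) (p : Fin 4 × Fin 4 → ℝ → ℝ), 0 < c ∧
      (∀ᶠ β in atTop, a β ≤ c * Transport.uRec β) ∧ 0 < ℓ₁ ∧ 0 < C₁ ∧ (∀ q β, |p q β| ≤ P₀) ∧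
      ∀ β : ℝ, β₁ ≤ β → ∀ (L n : ℕ) (q : Fin n → Fin 4 × Fin 4) (x : Fin n → (Fin 4 → ℤ)) (R : ℕ),
        (∀ i, (q i).1 < (q i).2) → 1 ≤ R → (R : ℝ) * a β ≤ ℓ₁ → 4 * R + 8 ≤ L →
        (∀ i j : Fin n, i ≠ j → ∃ k : Fin 4,
          (2 * (R : ℤ) + 4) ≤ |((((x i k - x j k : ℤ) : ZMod (2 * L + 1))).valMinAbs : ℤ)|) →
        ∀ T : Finset (Fin n),
          torusE (Matrix.specialUnitaryGroup (Fin 2) ℂ) (fundamentalLatticeRep 2) β L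
            (fun U => Real.exp (∑ i ∈ T, (R : ℝ) ^ 4 / C₁ *
              |kerE (Matrix.specialUnitaryGroup (Fin 2) ℂ) (fundamentalLatticeRep 2) β (fun k => x i k - (R + 1)) (2 * R + 3) U
                (plane (Matrix.specialUnitaryGroup (Fin 2) ℂ) (fundamentalLatticeRep 2) (q i) (x i)) - p (q i) β|)) ≤
            Real.exp (B * T.card) := by
  obtain ⟨β₁', h⟩ := responseMoments_of_quadratic_and_uniformConditionalRarity (N := 2) a 𝔟 m hm hm7 ε kmax Q MQ hQm hQb hsplit hEMQ
    (by simpa using hδ₀) w hw0 hw1 hUCR hD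
  exact ⟨a, c, C₁, A₀ + max B_Q (2 * Real.exp (2 * 1) * (1536 * (Δ₀ + D))), β₁', ℓ₁, P₀, p, hc, hle, hℓ₁, hC₁, hp, h⟩

end Unit

end Summit.QuantumFields.YangMills.Cruxes.UVSeamRec.DLRPeeling

end
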